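import Summits.CriticalPhenomena.PercolationContinuityZ3.Theorems.PercAnnulusCrossingIICRootedCylinders
import HarnessLib

/-!
# A box minus one shell point is lattice-connected from the origin: the two-staircase lemma (lane RSW3, p1 gen 8)

builds on p205010 (kernel theorem, internal audit signed; external expert review pending) — NOT used (pure lattice combinatorics).

RSW3 lane (LANE 3 `prim-rsw3`), seat `prim-rsw3-p1` (gen 8).  Helper file (`--supports stmt-CriticalPhenomena-4575`); no definitions, no sorries.
The geometric datum needed to extend `…IICEdgeBias` from radial to ALL edges (P1-QM §20.25):

* `update_mem_box_of_between` — the staircase points `update (prefix_j x) j t`, `t` between `0` and `x_j`, lie in `Λ(n)` when `x ∈ Λ(n)`;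
* `two_staircases` — if BOTH the increasing-order staircase `0 → x` and the decreasing-order staircase `0 → x` pass through `b`, then
  `b = 0` or `b = x` … precisely: impossible when `x ≠ b`, `b ∉ Λ(n−1)`, `x ∈ Λ(n)`, `n ≥ 1`;
* **`pathIn_box_sdiff_singleton_zero`** — `d` arbitrary, `n ≥ 1`, `b ∈ Λ(n) ∖ Λ(n−1)` (a shell point), `x ∈ Λ(n)`, `x ≠ b` ⇒
  `PathIn (zdGraph d) (↑Λ(n) ∖ {b}) 0 x` — one of the two staircases avoids `b`.
References: folklore (lattice paths).
-/

noncomputable section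

namespace Summit.CriticalPhenomena.PercolationContinuityZ3.Theorems.Crossing

open Literature.Probability.Percolation Literature.Probability.LatticeModels
open Literature.Probability.Percolation.DCT16

variable {d : ℕ}

/-- A point all of whose coordinates are coordinates of `x ∈ Λ(n)`, `0`, or a value between `0` and some `x_j`, lies in `Λ(n)`. [folklore] -/
theorem update_mem_box_of_between {n : ℕ} {x z : Site d} (hx : x ∈ box d n) (hz : ∀ i, z i = x i ∨ z i = 0) (j : Fin d) {t : ℤ}
    (ht : min 0 (x j) ≤ t ∧ t ≤ max 0 (x j)) : Function.update z j t ∈ box d n := by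
  rw [mem_box] at hx ⊢
  intro i
  by_cases hij : i = j
  · subst hij
    rw [Function.update_self]
    have := hx i
    rcases le_total 0 (x i) with h0 | h0
    · rw [min_eq_left h0, max_eq_right h0] at ht; omega
    · rw [min_eq_right h0, max_eq_left h0] at ht; omega
  · rw [Function.update_of_ne hij]
    rcases hz i with h | h
    · rw [h]; exact hx i
    · rw [h]; constructor <;> omega

/-- **The two-staircase lemma**: if the increasing-order staircase from `0` to `x` passes through `b` at step `j` and the decreasing-order one
passes through `b` at step `m`, then `b = 0` (`j < m`), `b = x` (`j > m`), or (`j = m`) `x` and `b` are multiples of `e_j` with `b_j` between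
`0` and `x_j` — all excluded when `x ∈ Λ(n)`, `b ∉ Λ(n−1)`, `n ≥ 1`, `x ≠ b`. [folklore] -/
theorem two_staircases {n : ℕ} (hn : 1 ≤ n) {x b : Site d} (hx : x ∈ box d n) (hb : b ∉ box d (n - 1)) (hxb : x ≠ b)
    {j : Fin d} {t : ℤ} (ht : min 0 (x j) ≤ t ∧ t ≤ max 0 (x j)) (h1 : Function.update (fun i : Fin d => if (i : ℕ) < (j : ℕ) then x i else 0) j t = b)
    {m : Fin d} {t' : ℤ} (h2 : Function.update (fun i : Fin d => if (m : ℕ) + 1 ≤ (i : ℕ) then x i else 0) m t' = b) : False := by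
  have e1 : ∀ i : Fin d, b i = if i = j then t else if (i : ℕ) < j then x i else 0 := by
    intro i; rw [← h1]
    by_cases hij : i = j
    · subst hij; simp
    · rw [Function.update_of_ne hij]; simp [hij]
  have e2 : ∀ i : Fin d, b i = if i = m then t' else if (m : ℕ) + 1 ≤ i then x i else 0 := by
    intro i; rw [← h2]
    by_cases him : i = m
    · subst him; simp
    · rw [Function.update_of_ne him]; simp [him]
  rw [mem_box] at hx
  rw [mem_box, not_forall] at hb
  obtain ⟨i₀, hi₀⟩ := hb
  rcases lt_trichotomy (j : ℕ) m with hjm | hjm | hjm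
  · -- `j < m`: `b = 0`
    have hb0 : ∀ i : Fin d, b i = 0 := by
      intro i
      by_cases hi : (i : ℕ) < m
      · have him : i ≠ m := fun h => by rw [h] at hi; exact lt_irrefl _ hi
        rw [e2 i, if_neg him, if_neg (by omega)]
      · have hij : i ≠ j := fun h => by rw [h] at hi; exact hi hjm
        rw [e1 i, if_neg hij, if_neg (by omega)]
    have := hb0 i₀
    omega
  · -- `j = m`: `x = x_j e_j`, `b = t e_j`, `t` between `0` and `x_j`, `|t| ≥ n` forces `b = x`
    have hjm' : j = m := Fin.ext hjm
    subst hjm'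
    have hother : ∀ i : Fin d, i ≠ j → b i = 0 ∧ x i = 0 := by
      intro i hij
      have hne : (i : ℕ) ≠ j := fun h => hij (Fin.ext h)
      rcases Nat.lt_or_gt_of_ne hne with hi | hi
      · refine ⟨by rw [e2 i, if_neg hij, if_neg (by omega)], ?_⟩
        have hb1 := e1 i; rw [if_neg hij, if_pos hi] at hb1
        have hb2 := e2 i; rw [if_neg hij, if_neg (by omega)] at hb2
        rw [← hb1, hb2]
      · refine ⟨by rw [e1 i, if_neg hij, if_neg (by omega)], ?_⟩
        have hb1 := e1 i; rw [if_neg hij, if_neg (by omega)] at hb1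
        have hb2 := e2 i; rw [if_neg hij, if_pos (by omega)] at hb2
        rw [← hb2, hb1]
    have hbj : b j = t := by rw [e1 j, if_pos rfl]
    -- the shell coordinate must be `j`
    have hi₀j : i₀ = j := by
      by_contra h
      have := (hother i₀ h).1
      omega
    subst hi₀j
    rw [hbj] at hi₀
    have hxj := hx i₀
    apply hxb
    funext i
    by_cases hij : i = i₀
    · subst hij
      rw [hbj]
      rcases le_total 0 (x i) with h0 | h0
      · rw [min_eq_left h0, max_eq_right h0] at ht; omega
      · rw [min_eq_right h0, max_eq_left h0] at ht; omega
    · rw [(hother i hij).1, (hother i hij).2]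
  · -- `j > m`: `b = x`
    apply hxb
    funext i
    by_cases hi : (m : ℕ) < i
    · have him : i ≠ m := fun h => by rw [h] at hi; exact lt_irrefl _ hi
      rw [e2 i, if_neg him, if_pos (by omega)]
    · have hij : i ≠ j := fun h => by rw [h] at hi; exact hi hjm
      rw [e1 i, if_neg hij, if_pos (by omega)]

/-- **A box minus one shell point is lattice-connected from the origin**: for `n ≥ 1`, a shell point `b ∈ Λ(n) ∖ Λ(n−1)` (only `b ∉ Λ(n−1)` is
used), `x ∈ Λ(n)` with `x ≠ b`: `PathIn (zdGraph d) (↑Λ(n) ∖ {b}) 0 x` — one of the two coordinate staircases from `0` to `x` avoids `b`.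
[folklore] -/
theorem pathIn_box_sdiff_singleton_zero {n : ℕ} (hn : 1 ≤ n) {x b : Site d} (hx : x ∈ box d n) (hb : b ∉ box d (n - 1)) (hxb : x ≠ b) :
    PathIn (zdGraph d) ((↑(box d n) : Set (Site d)) \ {b}) 0 x := by
  classical
  set S : Set (Site d) := (↑(box d n) : Set (Site d)) \ {b} with hS
  have h0S : (0 : Site d) ∈ S := by
    refine ⟨Finset.mem_coe.2 (zero_mem_box d n), fun h => hb ?_⟩
    rw [Set.mem_singleton_iff] at h
    rw [← h]; exact zero_mem_box d (n - 1)
  -- the two staircases: prefix points `P j` (coordinates `< j` from `x`) and suffix points `Q j` (coordinates `≥ j` from `x`)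
  set P : ℕ → Site d := fun j i => if (i : ℕ) < j then x i else 0 with hP
  set Q : ℕ → Site d := fun j i => if j ≤ (i : ℕ) then x i else 0 with hQ
  have hP0 : P 0 = 0 := by funext i; simp [hP]
  have hPd : P d = x := by funext i; simp [hP, i.2]
  have hQd : Q d = 0 := by funext i; simp [hQ, not_le.2 i.2]
  have hQ0 : Q 0 = x := by funext i; simp [hQ]
  have hPsucc : ∀ j : Fin d, P (j + 1) = Function.update (P j) j (x j) := by
    intro j; funext i
    by_cases hij : i = j
    · subst hij; simp [hP]
    · have hne : (i : ℕ) ≠ j := fun h => hij (Fin.ext h)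
      rw [Function.update_of_ne hij]
      simp only [hP]
      by_cases h1 : (i : ℕ) < j
      · simp [h1, show (i : ℕ) < j + 1 by omega]
      · simp [h1, show ¬ (i : ℕ) < j + 1 by omega]
  have hQpred : ∀ j : Fin d, Q j = Function.update (Q (j + 1)) j (x j) := by
    intro j; funext i
    by_cases hij : i = j
    · subst hij; simp [hQ]
    · have hne : (i : ℕ) ≠ j := fun h => hij (Fin.ext h)
      rw [Function.update_of_ne hij]
      simp only [hQ]
      by_cases h1 : (j : ℕ) + 1 ≤ i
      · simp [h1, show (j : ℕ) ≤ i by omega]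
      · simp [h1, show ¬ (j : ℕ) ≤ i by omega]
  have hPcoord : ∀ (j : ℕ) (i : Fin d), P j i = x i ∨ P j i = 0 := by
    intro j i; simp only [hP]; split_ifs <;> simp
  have hQcoord : ∀ (j : ℕ) (i : Fin d), Q j i = x i ∨ Q j i = 0 := by
    intro j i; simp only [hQ]; split_ifs <;> simp
  by_cases hA : ∀ (j : Fin d) (t : ℤ), min 0 (x j) ≤ t → t ≤ max 0 (x j) → Function.update (P j) j t ≠ b
  · -- the increasing staircase avoids `b`
    have key : ∀ j : ℕ, j ≤ d → PathIn (zdGraph d) S 0 (P j) := by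
      intro j
      induction j with
      | zero => intro _; rw [hP0]; exact PathIn.refl h0S
      | succ j ih =>
        intro hj
        have hjd : j < d := by omega
        have hPj := ih hjd.le
        rw [show P (j + 1) = Function.update (P j) ⟨j, hjd⟩ (x ⟨j, hjd⟩) from hPsucc ⟨j, hjd⟩]
        have hseg : ∀ t : ℤ, min (P j ⟨j, hjd⟩) (x ⟨j, hjd⟩) ≤ t → t ≤ max (P j ⟨j, hjd⟩) (x ⟨j, hjd⟩) →
            Function.update (P j) ⟨j, hjd⟩ t ∈ S := by
          intro t ht1 ht2
          have hpj : P j ⟨j, hjd⟩ = 0 := by simp [hP]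
          rw [hpj] at ht1 ht2
          exact ⟨Finset.mem_coe.2 (update_mem_box_of_between hx (hPcoord j) ⟨j, hjd⟩ ⟨ht1, ht2⟩),
            fun h => hA ⟨j, hjd⟩ t ht1 ht2 (Set.mem_singleton_iff.1 h)⟩
        have hend : Function.update (P j) ⟨j, hjd⟩ (x ⟨j, hjd⟩) ∈ S := hseg _ (min_le_right _ _) (le_max_right _ _)
        exact hPj.trans (pathIn_of_induce_reachable (induce_reachable_update (S := S) (P j) ⟨j, hjd⟩ (x ⟨j, hjd⟩) hseg hPj.right_mem hend))
    have h := key d le_rfl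
    rwa [hPd] at h
  · by_cases hB : ∀ (j : Fin d) (t : ℤ), min 0 (x j) ≤ t → t ≤ max 0 (x j) → Function.update (Q (j + 1)) j t ≠ b
    · -- the decreasing staircase avoids `b`
      have key : ∀ k : ℕ, k ≤ d → PathIn (zdGraph d) S 0 (Q (d - k)) := by
        intro k
        induction k with
        | zero => intro _; rw [Nat.sub_zero, hQd]; exact PathIn.refl h0S
        | succ k ih =>
          intro hk
          have hjd : d - (k + 1) < d := by omega
          have hPj := ih (by omega)
          have hidx : d - k = d - (k + 1) + 1 := by omega
          rw [hidx] at hPj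
          rw [show Q (d - (k + 1)) = Function.update (Q (d - (k + 1) + 1)) ⟨d - (k + 1), hjd⟩ (x ⟨d - (k + 1), hjd⟩) from
            hQpred ⟨d - (k + 1), hjd⟩]
          have hseg : ∀ t : ℤ, min (Q (d - (k + 1) + 1) ⟨d - (k + 1), hjd⟩) (x ⟨d - (k + 1), hjd⟩) ≤ t →
              t ≤ max (Q (d - (k + 1) + 1) ⟨d - (k + 1), hjd⟩) (x ⟨d - (k + 1), hjd⟩) →
              Function.update (Q (d - (k + 1) + 1)) ⟨d - (k + 1), hjd⟩ t ∈ S := by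
            intro t ht1 ht2
            have hpj : Q (d - (k + 1) + 1) ⟨d - (k + 1), hjd⟩ = 0 := by simp [hQ]
            rw [hpj] at ht1 ht2
            exact ⟨Finset.mem_coe.2 (update_mem_box_of_between hx (hQcoord _) ⟨d - (k + 1), hjd⟩ ⟨ht1, ht2⟩),
              fun h => hB ⟨d - (k + 1), hjd⟩ t ht1 ht2 (Set.mem_singleton_iff.1 h)⟩
          have hend : Function.update (Q (d - (k + 1) + 1)) ⟨d - (k + 1), hjd⟩ (x ⟨d - (k + 1), hjd⟩) ∈ S :=
            hseg _ (min_le_right _ _) (le_max_right _ _)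
          exact hPj.trans (pathIn_of_induce_reachable
            (induce_reachable_update (S := S) (Q (d - (k + 1) + 1)) ⟨d - (k + 1), hjd⟩ (x ⟨d - (k + 1), hjd⟩) hseg hPj.right_mem hend))
      have h := key d le_rfl
      rwa [Nat.sub_self, hQ0] at h
    · -- both staircases hit `b`: impossible
      exfalso
      push Not at hA hB
      obtain ⟨j, t, ht1, ht2, h1⟩ := hA
      obtain ⟨m, t', -, -, h2⟩ := hB
      have h1' : Function.update (fun i : Fin d => if (i : ℕ) < (j : ℕ) then x i else 0) j t = b := by
        simpa only [hP] using h1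
      have h2' : Function.update (fun i : Fin d => if (m : ℕ) + 1 ≤ (i : ℕ) then x i else 0) m t' = b := by
        simpa only [hQ] using h2
      exact two_staircases hn hx hb hxb ⟨ht1, ht2⟩ h1' h2'

end Summit.CriticalPhenomena.PercolationContinuityZ3.Theorems.Crossing
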